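import Summits.BirchSwinnertonDyer.Rank1Residual.Additive.WildThreeJetchevAtThree
import Summits.BirchSwinnertonDyer.Rank1Residual.X11b.Three.JetchevKummerLink
import HarnessLib

/-!
# O6 — T-O6-J is a READING, not an open conjecture: the proof route of Jetchev's bound at the
# Tamagawa prime `q = p = 3 ∣ N` (Kodaira IV / IV*, `c₃ = 3`), its one O6-specific kernel input
# (`[𝓛₃ : H¹_{Kum⁰}] = 3` exactly), and the per-pair closure criterion it buys
# (cell `b2b-bsdres`, team o5o6, seat O6 planner 2 "non-Iwasawa side", GEN 3; THEOREMS ONLY, no fact, no `sorry`)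

HONEST FRAMING (cell `b2b-bsdres`, run/shared/lean/b2b/bsd-rank1-residual/, verbatim in every file): the
goal of the cell is to DELETE the COMBINATION-SHAPED residual classes of the Birch–Swinnerton-Dyer formula
for ALL analytic-rank `≤ 1` elliptic curves over `ℚ`, assembled STRICTLY from published theorems, so that
the rank-`≤ 1` remainder becomes exactly the CONSTRUCTION-SHAPED classes, which are TYPED (missing-input
`Prop`s), NOT attempted. Research routes; no claim beyond stated classes; census output = EVIDENCE /
conjecture items, never a Literature fact. NOTHING is booked here; the conjecture `def`s of GEN 2
(`AdditiveThree.JetchevBoundAtP`, `AdditiveThree.O6JetchevAtThree`) are NOT discharged by this file.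

## What changed since GEN 2 (harvest-2 §E66 and the X11b `JET3-KUMMER` files)

GEN 2 typed T-O6-J = `O6JetchevAtThree` ("Jetchev 2008 Cor. 1.5 at the Tamagawa prime `q = p = 3`,
outside Hypothesis (∗)'s `p ∤ N`") as an OPEN CONJECTURE. Two things landed the same day:

* harvest-2 GEN 29, HARVEST.md §E66 (C)(ii) "L-JET-v∣p" (a READING, referee-flagged `JET@p|N`; in
  print the statement does NOT exist — E66 Q1: 13 refereed sources checked, none drops `p ∤ N`; Miller
  J. Number Theory 131 (2011) Thm. 5.4 restates it without proof): in Jetchev's printed proof the clause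
  `p ∤ N` enters at exactly ONE step, Lemma 4.3 (arXiv math/0703431 p. 9: "`v ∤ p` ⇒ `E⁰(K_v^ur)` is
  `p`-divisible"), used only inside Prop. 4.1 (= arXiv Prop. 4.9, pp. 12–13) to put `loc_v κ_{c,m}` into the
  CONNECTED Kummer condition `H¹_{Kum⁰}(K_v, E[p^m]) = δ_v(E⁰(K_v))` at the places `v ∣ N`; and that step
  has a `v ∣ p`-proof replacement: the component-group / Bezout argument with `n′ = #E(ℚ)_tors`
  (kernel core `X11b.JetchevConnectedKummerCore.exists_fixed_sub_smul_mem_ker`, p248445). Everything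
  else (Lemma 3.2 "p odd", local Tate duality and self-orthogonality of `H¹_Kum` at ALL `v`, Thm. 3.3
  Poitou–Tate, §§5–7: Lemma 6.1, Thm. 6.3, Prop. 6.4) has no `p`-versus-`N` step. This seat re-derived the
  same page map independently (NOTES.md §Page map) and concurs.
* Team x11b3 (LEAD DEAL #3a `JET3-KUMMER`) typed E66's local step in KUMMER currency over GENERAL local
  fields: `X11b/Three/JetchevKummerLink.lean` (p253058: `connectedKummerCondition`,
  `[𝓛 : Kum⁰] = [E(E) : E₀ + n E(E)] ∣ c_v`, `= 𝓛` when `gcd(c_v, n) = 1`, Prop. 4.1 at a bad place in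
  Kummer currency from the explicit cocycle), `JetchevKummerAtP.lean`, `GoodReductionSubgroupGaloisH1.lean`
  (hypothesis (α) via cyclic `H¹`), `GoodReductionSubgroupUnramified.lean` (p252555). Their named inputs:
  (a) Gross 1991 Prop. 6.2 (1) at `v ∣ N`; (b) `n′ y ∈ E₀` for the Heegner points ([GZ86, III (3.1)]) and
  "integrality of `R_σ`"; (α) `H¹(Gal(L/F), E₀(L)) = 0`; `hstab`.

CONSEQUENCE FOR O6. Jetchev's Cor. 1.5 at `q = p = 3`, `27 ∣ N`, Kodaira IV / IV* is the SAME reading: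
nothing in E66 / JET3-KUMMER uses the reduction TYPE at `v ∣ p` — `F = K_v = ℚ₃` (`3 ∣ N` splits in the
Heegner field), `L = K[c]_w` is unramified over `ℚ₃` (`3 ∤ c·d_K`), the `3`-minimal equation stays minimal
over `L` (AEC VII.5.4 (a), `e = 1`), `Φ_w(k_w) ⊇ Φ₃(𝔽₃) ≅ ℤ/3` at IV / IV*. So **T-O6-J's status is
"READING-level theorem (unrefereed), kernel-closable modulo the E66 (D) list"**, not "open conjecture /
nothing in print at an additive p" as GEN 2 wrote. The O6-SPECIFIC items of that list are exactly three:

* (O6-i) the index form at a PRIME Tamagawa number dividing the modulus — THIS FILE, §§1–3: at IV / IV*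
  `c₃ = 3 ∣ 3^m` for every `m ≥ 1`, so `[𝓛₃ : H¹_{Kum⁰}(ℚ₃, E[3^m])] = 3` EXACTLY
  (`relIndex_connectedKummerCondition_three_eq_three`): the connected refinement is NEVER vacuous on a
  `c₃ = 3` row (contrast x11b3's bucket A, `connectedKummerCondition_padic_eq_of_not_dvd`), and the local
  quotient Jetchev's Thm. 6.3 feeds into the Selmer structure at `v, v̄ ∣ 3` is `ℤ/3` on each side, i.e.
  `m_v = 1 = ord₃ c₃` as Lemma 3.2 wants — with NO cyclicity hypothesis (Lagrange in `E/E₀` suffices when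
  `c_v ∣ n`; general lemma `relIndex_connectedKummerCondition_eq_localTamagawaNumber_of_dvd`).
* (O6-ii) hypothesis (α) at an ADDITIVE place: `E₀(L) ⊋ E₁(L)` with `E₀/E₁ ≅ 𝔾_a(k_L)` (cuspidal
  reduction) instead of `𝔾_m` / an elliptic curve; `H¹(Gal(L/ℚ₃), k_L⁺) = 0` (additive Hilbert 90) and
  `H¹(Gal(L/ℚ₃), Ê(𝔪_L)) = 0` (filtration with `𝔾_a` graded pieces, completeness) give (α) as at a
  multiplicative place [MilneADT2006, I.3.8; GrossLMS1991 p. 244]. ASK A-O6-J6 to x11b3: confirm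
  `GoodReductionSubgroupGaloisH1.hα_of_cyclicH1` is reduction-type-agnostic (its "halves").
* (O6-iii) [GZ86, III (3.1)] at `v₃(N) ≥ 2`: Heegner divisors `(x) − (∞)` reduce into `J₀(N)⁰` up to the
  cuspidal torsion `(0) − (∞)` at every place `w ∣ 3` of `K[c]` — on the Katz–Mazur model of `X₀(N)` over
  `ℤ₃` with `27 ∣ N` the special fibre has more than two components and the statement needed is "CM points
  with `3` split in `K` reduce into the two EXTREME (Igusa) components containing the cusps". PAGE-CHECK
  OPEN (ask A-O6-C4 of GEN 1; held scan `paper:doi-10-1007-bf01388809` is textless). This is input (b) of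
  x11b3 too, but there `p ∥ N` (Deligne–Rapoport, two components) — the `p² ∣ N` case is O6's own risk.

NOT O6-specific and IN TREE already (do not re-derive): "integrality of `R_σ`" — for every
`σ ∈ Gal(K[c]/K)` the root `R_σ` (`p^m R_σ = (σ−1)P_c`) lies in any `Gal`-stable subgroup containing the
Heegner points `y_c, y_{c/ℓ}` — is `Literature…KolyvaginEuler.smul_kolyvaginPoint_sub_mem` (with
`smul_sub_mem_of_mem_closure`, `smul_sum_smul_sub_mem`, `smul_grAct_derivProd_sub_mem`,
`HeegnerPointsKolyvaginPrimaryEulerProofs.lean`) applied to that submodule [GrossLMS1991, Prop. 3.6, (4.1),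
proof of Prop. 6.2 (2) (book pp. 221–222)].

## §4 What T-O6-J buys per pair (closure criterion; linear bookkeeping over the GEN-2 predicate)

`padicValNat_card_sha_eq_zero_of_jetchevBoundAtP`: `JetchevBoundAtP W 3`, a Heegner pair `(N, K, P)` as in
its binders with `3 ∣ N`, `3 ∣ c₃(W)` and `ord₃ [W(K) : ℤP] ≤ 1` force `ord₃ #Ш(W/K)[3^∞] = 0`
(`0 + 2·1 ≤ ord₃ #Ш + 2 ord₃ c₃ ≤ 2 ord₃ I ≤ 2`); with `Ш(W/K)` finite, `#Ш(W/K)[3^∞] = 1`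
(`card_primaryComponent_sha_eq_one_of_jetchevBoundAtP`). Census reading (EVIDENCE, GEN-1/2 tables
`o6r2_window_rows.tsv`, `gen2/o6r2g2_routeA_canaries.tsv`; nothing asserted): BSD over `K` then predicts
`ord₃ #Ш(E/K) = 2(ord₃ I − ord₃(c·∏_q c_q)) = 2(1 − 1 − Σ_{q≠3} ord₃ c_q − ord₃ c)`, so the criterion is
CONSISTENT with BSD exactly on SINGLE-CARRIER rows (`3 ∤ c_q` for `q ≠ 3`, `3 ∤ c_Manin`), where it closes
BSD₃(E/K) outright and reduces BSD₃(E/ℚ) to the exact twist check `ord₃ Ш_an(E^D) = 0` (tree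
`card_primaryComponent_sha_baseChange_quadratic_of_odd` + `bsdp_iff_padicValRat_eq_zero_of_card_primaryComponent_eq_one`).
In the 129-row wild residue WINDOW every `t = 1 ∧ c₃ = 3` row is index-LOCKED (`ord₃ I_D = 2` on every
certified field: 19467d1, 11880p1, 13770bq1, 14850bg1, 14850bz1, 19170bf1), so T-O6-J closes NO residue
row by itself there — the rows it closes (`ord₃ I_D = 1 = ord₃ c₃`) were booked by the lane under flag
`JETpN`; T-O6-J is what JUSTIFIES those bookings at an additive `q = p`, and it supplies `m_∞ ≥ 1` to the
derived-class certificate route R-O6-C0 on the locked rows (seat memo `gen3/O6-GEN3.md`, tests (J2′)/(J3)).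

## §5 Per-pair placement of T-O6-J on the whole rank-one O6 residue (GEN 3 scan; EVIDENCE, nothing asserted)

A pure read of Cremona's `ecdata` (`allbsd` × `galrep`, one curve per isogeny class, `N < 5·10⁵`, `27 ∣ N`,
`r = 1`, `E[3]` irreducible): `ord₃ Ш_an(E) = 0` on 89 377 classes and `= 2` on exactly TEN (298134c1,
309123d1, 350919k1, 352944s1, 371682b1, 412317d1, 412587c1, 431784d1, 441099r1, 459135f1), all ten with
`v₃(N) = 3` and `3 ∤ ∏_q c_q` (`t = 0`). Consequently NO rank-one O6 pair needs T-O6-J for its own closure: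
(i) a pair with `3 ∤ Ш_an(E)` closes from ONE exact `3`-descent line `#Sel^(3)(E/ℚ) = 3` by the CLASS-FREE
consumer `Literature.NumberTheory.EllipticCurves.Rank1Residual.Typed.bsdp_of_card_selmerGroup_eq_pow_analyticRank`
(binders: GZK, `r_an ≤ 1`, `shaAn W = q` with `padicValRat 3 q = 0`, the count) — no Euler-system input at
the additive prime at all (instrument `SEL3CT@3` = the x11b `desc3lib` EXACT engine, STEP-0 PASS; the
129-row window list is `gen3/o6r2g3_sel3ct_r1_targets.tsv`); (ii) the ten `Ш_an = 9` classes are `t = 0`,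
so `Summit.BirchSwinnertonDyer.Rank1Residual.X11b.bsdp_of_kolyvagin_of_card_selmer` (reduction-type-free
despite its namespace: Kolyvagin/McCallum UPPER `ord₃ #Ш(E/K) ≤ 2·ord₃ I_K` at a rescue field with
`ord₃ I_K ≤ 1`, LOWER `#Sel^(3) = 27`) is their key, again without any Tamagawa credit. T-O6-J is
therefore a CLASS-LEVEL rung only (an ingredient of the conjectural class statement T-O6-C /
`O5.O6HeegnerIndexThree`, and the justification of `JETpN`-flagged index bookings at an additive `3`);
its census tests (J2′)/(J3) calibrate the structure predictions, they are not closure instruments.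

References (locators only): [cite: Jetchev2008, Lemma 3.2 (p. 814), Prop. 4.1 (p. 819), Lemmas 4.2–4.3
(p. 820), Thm. 6.3] [cite: GrossLMS1991, Prop. 3.6, (4.1), Prop. 6.2 (pp. 244–245)]
[cite: GrossZagier1986, III (3.1)] [cite: MilneADT2006, Ch. I Prop. 3.8] [cite: Miller2011, Thm. 5.4].
-/

noncomputable section

open scoped Classical

open WeierstrassCurve Literature.NumberTheory.EllipticCurves
  Literature.NumberTheory.EllipticCurves.ModularForms
  Literature.NumberTheory.EllipticCurves.Rank1Residual
  Literature.NumberTheory.EllipticCurves.Rank1Residual.Typed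
  Summit.BirchSwinnertonDyer.Rank1Residual.X11b.Three.JetchevKummer

namespace Summit.BirchSwinnertonDyer.Rank1Residual.AdditiveThree

universe u

/-! ## §1 Group theory: a subgroup whose index divides `n` absorbs `n·A` -/

section GroupTheory

variable {A : Type*} [AddCommGroup A] (H : AddSubgroup A)

/-- If `[A : H] ∣ n` then `n • a ∈ H` for every `a` (Lagrange in `A ⧸ H`: `[A : H] • a ∈ H`,
Mathlib `AddSubgroup.nsmul_index_mem`). Index `0` (infinite) forces `n = 0`. [folklore] -/
theorem zsmul_mem_of_index_dvd {n : ℤ} (h : (H.index : ℤ) ∣ n) (a : A) : n • a ∈ H := by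
  obtain ⟨k, rfl⟩ := h
  rw [mul_comm, mul_zsmul, natCast_zsmul]
  exact H.zsmul_mem (AddSubgroup.nsmul_index_mem H a) k

/-- `n·A ≤ H` when `[A : H] ∣ n`. [folklore] -/
theorem range_zsmulAddGroupHom_le_of_index_dvd {n : ℤ} (h : (H.index : ℤ) ∣ n) :
    (zsmulAddGroupHom n : A →+ A).range ≤ H := by
  rintro _ ⟨a, rfl⟩
  exact zsmul_mem_of_index_dvd H h a

/-- `H + n·A = H` when `[A : H] ∣ n`. [folklore] -/
theorem sup_range_zsmulAddGroupHom_eq_of_index_dvd {n : ℤ} (h : (H.index : ℤ) ∣ n) :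
    H ⊔ (zsmulAddGroupHom n : A →+ A).range = H :=
  sup_eq_left.mpr (range_zsmulAddGroupHom_le_of_index_dvd H h)

/-- `[A : H + n·A] = [A : H]` when `[A : H] ∣ n` — the index is not lowered by adding `n·A`.
[folklore] -/
theorem index_sup_range_zsmulAddGroupHom_eq_of_index_dvd {n : ℤ} (h : (H.index : ℤ) ∣ n) :
    (H ⊔ (zsmulAddGroupHom n : A →+ A).range).index = H.index := by
  rw [sup_range_zsmulAddGroupHom_eq_of_index_dvd H h]

end GroupTheory

/-! ## §2 Jetchev's Lemma 3.2 when `c_v ∣ n`: `[𝓛_E : H¹_{Kum⁰}] = c_v` exactly -/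

section Typed

variable {K : Type u} [Field K] [CharZero K] (W : WeierstrassCurve K) [W.IsElliptic]
  (E : Type u) [Field E] [CharZero E] [Algebra K E]
  (R : Type*) [CommRing R] [IsDomain R] [IsDiscreteValuationRing R] [Algebra R E]
  [IsFractionRing R E] [(W.baseChange E).IsMinimal R] {n : ℤ} (hn : n ≠ 0)

/-- **Jetchev's Lemma 3.2 in the case `c_v ∣ n`** (x11b3's "bucket B", made exact): if the local Tamagawa
number `c_v = [(W⁄E)(E) : E₀(E)]` divides `n` then `n·(W⁄E)(E) ≤ E₀(E)` and
`[𝓛_E : H¹_{Kum⁰}(E, W[n])] = [(W⁄E)(E) : E₀(E) + n·(W⁄E)(E)] = c_v` — no cyclicity of the component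
group is needed. Built on `JetchevKummer.relIndex_connectedKummerCondition` (p253058).
[cite: Jetchev2008, Lemma 3.2 (p. 814)] -/
theorem relIndex_connectedKummerCondition_eq_localTamagawaNumber_of_dvd
    (hdvd : (((W.baseChange E).localTamagawaNumber R : ℕ) : ℤ) ∣ n) :
    (connectedKummerCondition W E R hn).relIndex (W.kummerLocalConditionAt n E) =
      (W.baseChange E).localTamagawaNumber R := by
  rw [relIndex_connectedKummerCondition W E R hn,
    WeierstrassCurve.localTamagawaNumber_eq_index_goodReductionSubgroup R (W.baseChange E)]
  rw [WeierstrassCurve.localTamagawaNumber_eq_index_goodReductionSubgroup R (W.baseChange E)] at hdvd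
  exact index_sup_range_zsmulAddGroupHom_eq_of_index_dvd _ hdvd

end Typed

/-! ## §3 At `ℚ_p`, and the O6 headline at `p = 3`, Kodaira IV / IV* -/

section Padic

variable (W : WeierstrassCurve ℚ) [W.IsElliptic] [W.IsGloballyMinimal] (p : ℕ) [Fact p.Prime]

/-- **At `q = p`: if `c_p(E) ∣ p^m` then `[𝓛_p : H¹_{Kum⁰}(ℚ_p, E[p^m])] = c_p(E)`** (for odd `p` at an
additive place `c_p ∈ {1, 3}` at `p = 3`, `c_p = 1` at `p ≥ 5`; at split multiplicative `I_{p^k}`,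
`c_p = p^k`). Complements `JetchevKummer.connectedKummerCondition_padic_eq_of_not_dvd` (bucket A).
[cite: Jetchev2008, Lemma 3.2 (p. 814)] -/
theorem relIndex_connectedKummerCondition_padic_eq_of_dvd (m : ℕ)
    (hdvd : (W.baseChange ℚ_[p]).localTamagawaNumber ℤ_[p] ∣ p ^ m) :
    (connectedKummerCondition W ℚ_[p] ℤ_[p] (n := ((p ^ m : ℕ) : ℤ))
        (Int.natCast_ne_zero.mpr (pow_ne_zero m (Fact.out : p.Prime).ne_zero))).relIndex
      (W.kummerLocalConditionAt ((p ^ m : ℕ) : ℤ) ℚ_[p]) =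
      (W.baseChange ℚ_[p]).localTamagawaNumber ℤ_[p] :=
  relIndex_connectedKummerCondition_eq_localTamagawaNumber_of_dvd W ℚ_[p] ℤ_[p] _
    (Int.natCast_dvd_natCast.mpr hdvd)

/-- **O6 headline (O6-i): at Kodaira IV / IV* (`c₃(E) = 3`) the connected Kummer condition at `ℚ₃` has
index EXACTLY `3` in `𝓛₃ = H¹_Kum(ℚ₃, E[3^m])` for every `m ≥ 1`** — Jetchev's `m_v = ord₃ c₃ = 1` at the
Tamagawa prime `q = p = 3`, the local quotient his Thm. 6.3 inserts at `v, v̄ ∣ 3`. The refinement of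
Prop. 4.1 at `v ∣ 3` is therefore never vacuous on a `c₃ = 3` row (95 / 129 wild residue rows, GEN-1
census — EVIDENCE pointer, not an input). [cite: Jetchev2008, Lemma 3.2 (p. 814), Thm. 6.3] -/
theorem relIndex_connectedKummerCondition_three_eq_three (W : WeierstrassCurve ℚ) [W.IsElliptic]
    [W.IsGloballyMinimal] (hc : (W.baseChange ℚ_[3]).localTamagawaNumber ℤ_[3] = 3)
    {m : ℕ} (hm : 1 ≤ m) :
    (connectedKummerCondition W ℚ_[3] ℤ_[3] (n := ((3 ^ m : ℕ) : ℤ))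
        (Int.natCast_ne_zero.mpr (pow_ne_zero m (Fact.out : (3 : ℕ).Prime).ne_zero))).relIndex
      (W.kummerLocalConditionAt ((3 ^ m : ℕ) : ℤ) ℚ_[3]) = 3 := by
  have hdvd : (W.baseChange ℚ_[3]).localTamagawaNumber ℤ_[3] ∣ 3 ^ m := by
    rw [hc]
    exact dvd_pow_self 3 (by omega)
  have h := relIndex_connectedKummerCondition_padic_eq_of_dvd W 3 m hdvd
  rw [hc] at h
  exact h

end Padic

/-! ## §4 The per-pair closure criterion over the GEN-2 predicate `JetchevBoundAtP W 3` -/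

section Closure

variable (W : WeierstrassCurve ℚ) [W.IsElliptic]

/-- **What T-O6-J buys per pair**: from `JetchevBoundAtP W 3`, on a Heegner pair with `3 ∣ N`, `3 ∣ c₃(W)`
(Kodaira IV / IV*) and `ord₃ [W(K) : ℤ P] ≤ 1`, `ord₃ #Ш(W/K)[3^∞] = 0`. Pure arithmetic over the GEN-2
predicate (`c₃ ≠ 0` by `localTamagawaNumber_padic_ne_zero_holds`). Nothing asserted about
`JetchevBoundAtP` itself. [cite: Jetchev2008, Cor. 1.5 (p. 3)] -/
theorem padicValNat_card_sha_eq_zero_of_jetchevBoundAtP (h : JetchevBoundAtP W 3)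
    (N : ℕ) [NeZero N] (K : Type) [Field K] [NumberField K]
    (hK : IsImaginaryQuadratic K) (hD4 : NumberField.discr K < -4)
    (hH : SatisfiesHeegnerHypothesis N K)
    (hopt : ∃ Dt : ModularParametrizationData W N,
      ∀ z ∈ Dt.L.lattice, ∃ w ∈ periodLattice Dt.f, z = (Dt.c : ℂ) * w)
    {P : (W.baseChange K).toAffine.Point} (hP : IsHeegnerPoint N W K P) (hnt : ¬ IsOfFinAddOrder P)
    (h3N : 3 ∣ N) (hρ : W.HasSurjectiveModNGaloisRep 3)
    (hc : 3 ∣ (W.baseChange ℚ_[3]).localTamagawaNumber ℤ_[3])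
    (hI : padicValNat 3 (AddSubgroup.zmultiples P).index ≤ 1) :
    padicValNat 3 (Nat.card (AddCommGroup.primaryComponent (W.baseChange K).sha 3)) = 0 := by
  have hb := h N K hK hD4 hH hopt hP hnt (by norm_num) h3N hρ
  have hc0 : (W.baseChange ℚ_[3]).localTamagawaNumber ℤ_[3] ≠ 0 :=
    localTamagawaNumber_padic_ne_zero_holds 3 (W.baseChange ℚ_[3])
  have h1 : 1 ≤ padicValNat 3 ((W.baseChange ℚ_[3]).localTamagawaNumber ℤ_[3]) :=
    one_le_padicValNat_of_dvd hc0 hc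
  omega

/-- **Closure form**: under the same hypotheses and `Ш(W/K)` finite (true on every Heegner pair with `P`
of infinite order by Kolyvagin — supplied by the consumer, not assumed away), `#Ш(W/K)[3^∞] = 1`; the
quadratic split to `Ш(W/ℚ)[3^∞] = Ш(W^D/ℚ)[3^∞] = 0` is the tree's
`card_primaryComponent_sha_baseChange_quadratic_of_odd`. [cite: Jetchev2008, Cor. 1.5 (p. 3)] -/
theorem card_primaryComponent_sha_eq_one_of_jetchevBoundAtP (h : JetchevBoundAtP W 3)
    (N : ℕ) [NeZero N] (K : Type) [Field K] [NumberField K]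
    (hK : IsImaginaryQuadratic K) (hD4 : NumberField.discr K < -4)
    (hH : SatisfiesHeegnerHypothesis N K)
    (hopt : ∃ Dt : ModularParametrizationData W N,
      ∀ z ∈ Dt.L.lattice, ∃ w ∈ periodLattice Dt.f, z = (Dt.c : ℂ) * w)
    {P : (W.baseChange K).toAffine.Point} (hP : IsHeegnerPoint N W K P) (hnt : ¬ IsOfFinAddOrder P)
    (h3N : 3 ∣ N) (hρ : W.HasSurjectiveModNGaloisRep 3)
    (hc : 3 ∣ (W.baseChange ℚ_[3]).localTamagawaNumber ℤ_[3])
    (hI : padicValNat 3 (AddSubgroup.zmultiples P).index ≤ 1)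
    [Finite (W.baseChange K).sha] :
    Nat.card (AddCommGroup.primaryComponent (W.baseChange K).sha 3) = 1 := by
  obtain ⟨k, hk⟩ := exists_card_addPrimaryComponent_eq_pow (A := (W.baseChange K).sha) 3
  have h0 := padicValNat_card_sha_eq_zero_of_jetchevBoundAtP W h N K hK hD4 hH hopt hP hnt h3N hρ hc hI
  rw [hk, padicValNat.prime_pow] at h0
  rw [hk, h0, pow_zero]

end Closure

end Summit.BirchSwinnertonDyer.Rank1Residual.AdditiveThree

end
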